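import Summits.QuantumFields.YangMills.Theorems.AlphaInputsT3ACv3LinearLiftProfileIds
import HarnessLib

/-!
# `AlphaInputsT3ACv3LinearLiftTorus1D` — (LL) STEP L2a: THE ONE-DIMENSIONAL PROFILES ON A DISCRETE CIRCLE `ℤ/(n·N_k)` OVER `N_k` CELLS — indicator periodisation, exact cell
# sums, partition of unity, the chain identity and exact segment means ON THE TORUS — cell `ym3-torus`, width seat `ym-ust-19936-w2` (g0), OWNER re-point 2026-08-27T23:08Z

WHY.  The fine torus coordinate of `T_η` in one direction is `ℤ/N₀`, `N₀ = n·N_k` (`n = L^k = 2h+1` fine sites per level-`k` cell, `N_k` cells); a fine coordinate `a` has a cell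
index `q(a) = ⌊a/n⌋` and a centred offset `t(a) = a mod n − h ∈ [−h, h]`.  The profile of the cell `c` read at `a` is the INDICATOR PERIODISATION
`Pσ(a, c) = Σ_{r ∈ {−1,0,1}} [c ≡ q(a) − r] · σ(t(a) + r n)` (`PS`): the `ℤ`-profile of `AlphaInputsT3ACv3LinearLiftProfile` re-based at the cell of `a`, summed over the (at
most two) neighbouring positions — correct for EVERY `N_k ≥ 1` (for `N_k = 2` both `r = ±1` fire for the other cell, which is the honest periodisation).  This file proves the
torus forms of the four identities: §2 `Psig_cell` (Σ over a cell `= n·[c = c′]`), `Psig_pou` (Σ over cells `= 1`); §3 the shift lemmas `Psig_add_one`, `Ptau_add_nat`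
(boundary terms vanish by the supports), the CHAIN IDENTITY `Psig_add_one_sub : Pσ(a+1, c) − Pσ(a, c) = Pτ(a, c−1) − Pτ(a, c)`.  The exact segment means
`Ptau_seg` and the bounds are the sibling `AlphaInputsT3ACv3LinearLiftTorus1DSeg`; the `d`-dimensional tensor spreading on `Site (F.P K) 0` and the lift are files L2b∕L4 (plan:
HOME `ym3-torus/ym-ust-19936-w2/LL-PLAN-w2-g0.md`).
HONEST FRAMING.  Elementary bookkeeping on `ZMod`; nothing of [Balaban1987RG1]∕[Balaban1985UV3] asserted; count-neutral helper toward the (FL) row of 2′∕2′χ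
(`--supports stmt-QuantumFields-19936`); registry untouched.  YM₃ on the torus is a RUNG of the programme, not the Clay problem; no claim about d = 4, infinite volume or a mass gap.

References: T. Bałaban, Commun. Math. Phys. 109 (1987) 249–301 [Balaban1987RG1] ((0.1) p.251: the tori `T^{(j)}`, `L^j` sites per block side); Commun. Math. Phys. 102 (1985)
255–275 [Balaban1985UV3] ((38) p.266).
-/

set_option autoImplicit false

noncomputable section

namespace Summit.QuantumFields.YangMills.Theorems.LinearLiftProfile

open Finset

variable (h : ℕ) {N₀ Nk : ℕ}

/-! ## §1 Cell index, centred offset, and the indicator periodisation -/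

/-- The cell index `q(a) = ⌊a/n⌋` of a fine coordinate. [cite: Balaban1987RG1, (0.1) p.251] -/
def qIdx (a : ZMod N₀) : ℕ := a.val / side h

/-- The centred offset `t(a) = (a mod n) − h ∈ [−h, h]` of a fine coordinate from the centre of its cell. [cite: Balaban1987RG1, (0.1) p.252] -/
def tOff (a : ZMod N₀) : ℤ := ((a.val % side h : ℕ) : ℤ) - h

/-- The three relative positions. [folklore] -/
def trip : Finset ℤ := {-1, 0, 1}

/-- **THE INDICATOR PERIODISATION** of a `ℤ`-profile `f`: `PS f q t c = Σ_{r ∈ {−1,0,1}} [c ≡ q − r]·f(t + r n)`. [folklore] -/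
def PS (f : ℤ → ℝ) (q t : ℤ) (c : ZMod Nk) : ℝ :=
  ∑ r ∈ trip, if c = ((q - r : ℤ) : ZMod Nk) then f (t + r * side h) else 0

/-- **THE 0-FORM PROFILE OF THE CELL `c` READ AT THE FINE COORDINATE `a`.** [folklore] -/
def Psig (a : ZMod N₀) (c : ZMod Nk) : ℝ := PS h (sigma h) (qIdx h a) (tOff h a) c

/-- **THE 1-FORM PROFILE OF THE CELL `c` READ AT THE FINE COORDINATE `a`.** [folklore] -/
def Ptau (a : ZMod N₀) (c : ZMod Nk) : ℝ := PS h (tau h) (qIdx h a) (tOff h a) c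

/-- A sum over the three relative positions, spelled out. [folklore] -/
theorem sum_trip (f : ℤ → ℝ) : ∑ r ∈ trip, f r = f (-1) + f 0 + f 1 := by
  simp [trip, sum_insert, add_assoc]

/-- The decomposition `a = q·n + h + t` with `0 ≤ h + t < n`. [folklore] -/
theorem val_eq (a : ZMod N₀) : (a.val : ℤ) = (qIdx h a : ℤ) * side h + h + tOff h a := by
  unfold qIdx tOff
  have := Nat.div_add_mod a.val (side h)
  push_cast
  have e : ((a.val : ℕ) : ℤ) = ((side h * (a.val / side h) + a.val % side h : ℕ) : ℤ) := by rw [this]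
  push_cast at e
  linarith

/-- `t(a) ∈ [−h, h]`. [folklore] -/
theorem tOff_mem (a : ZMod N₀) : -(h : ℤ) ≤ tOff h a ∧ tOff h a ≤ h := by
  unfold tOff
  have h1 := Nat.mod_lt a.val (side_pos h)
  have h2 : side h = 2 * h + 1 := rfl
  constructor <;> omega

/-- `q(a) < N_k`. [folklore] -/
theorem qIdx_lt [NeZero N₀] (hN : N₀ = side h * Nk) (a : ZMod N₀) : qIdx h a < Nk := by
  unfold qIdx
  have : a.val < side h * Nk := lt_of_lt_of_eq (ZMod.val_lt a) hN
  exact Nat.div_lt_of_lt_mul this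

/-- `PS` is linear in the profile: subtraction. [folklore] -/
theorem PS_sub (f g : ℤ → ℝ) (q t : ℤ) (c : ZMod Nk) : PS h (fun s => f s - g s) q t c = PS h f q t c - PS h g q t c := by
  unfold PS
  rw [← sum_sub_distrib]
  refine sum_congr rfl fun r _ => ?_
  split_ifs <;> ring

/-- `PS` of a translated profile is `PS` at the translated offset. [folklore] -/
theorem PS_shift (f : ℤ → ℝ) (q t s : ℤ) (c : ZMod Nk) : PS h (fun u => f (u + s)) q t c = PS h f q (t + s) c := by
  unfold PS
  refine sum_congr rfl fun r _ => ?_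
  split_ifs
  · ring_nf
  · rfl

/-- **RE-BASING TO THE NEXT CELL**: `PS f (q+1) (t − n) c = PS f q t c` when `f(t + n) = f(t − 2n) = 0` (the two boundary positions leave resp. enter the window with value zero).
[folklore] -/
theorem PS_succ_sub_side (f : ℤ → ℝ) (q t : ℤ) (c : ZMod Nk) (h1 : f (t + side h) = 0) (h2 : f (t - 2 * side h) = 0) :
    PS h f (q + 1) (t - side h) c = PS h f q t c := by
  unfold PS
  rw [sum_trip, sum_trip]
  have e1 : ((q + 1 - -1 : ℤ) : ZMod Nk) = ((q - -1 : ℤ) : ZMod Nk) + 1 := by push_cast; ring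
  have e2 : ((q + 1 - 0 : ℤ) : ZMod Nk) = ((q - -1 : ℤ) : ZMod Nk) := by push_cast; ring
  have e3 : ((q + 1 - 1 : ℤ) : ZMod Nk) = ((q - 0 : ℤ) : ZMod Nk) := by push_cast; ring
  rw [e2, e3, show t - (side h : ℤ) + 0 * side h = t + -1 * side h by ring, show t - (side h : ℤ) + 1 * side h = t + 0 * side h by ring,
    show t - (side h : ℤ) + -1 * side h = t - 2 * side h by ring, h2]
  rw [show t + 1 * (side h : ℤ) = t + side h by ring, h1]
  simp

/-- Re-basing the CELL argument instead: `PS f (q+1) t c = PS f q t (c − 1)`. [folklore] -/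
theorem PS_succ_eq_pred (f : ℤ → ℝ) (q t : ℤ) (c : ZMod Nk) : PS h f (q + 1) t c = PS h f q t (c - 1) := by
  unfold PS
  refine sum_congr rfl fun r _ => ?_
  have : (c = ((q + 1 - r : ℤ) : ZMod Nk)) ↔ (c - 1 = ((q - r : ℤ) : ZMod Nk)) := by
    constructor
    · intro hc; rw [hc]; push_cast; ring
    · intro hc; rw [← sub_add_cancel c 1, hc]; push_cast; ring
  simp only [this]

/-- `PS f q t c` depends on `q` only through its class mod `N_k`. [folklore] -/
theorem PS_congr_mod (f : ℤ → ℝ) {q₁ q₂ : ℤ} (hq : ((q₁ : ℤ) : ZMod Nk) = ((q₂ : ℤ) : ZMod Nk)) (t : ℤ) (c : ZMod Nk) :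
    PS h f q₁ t c = PS h f q₂ t c := by
  unfold PS
  refine sum_congr rfl fun r _ => ?_
  rw [Int.cast_sub, Int.cast_sub, hq]

/-! ## §2 Exact cell sums and the partition of unity on the circle -/

/-- The fine coordinates of the cell `c′`. [folklore] -/
def cellFin [NeZero N₀] (c' : ZMod Nk) : Finset (ZMod N₀) := univ.filter fun a => qIdx h a = c'.val

/-- Membership in a cell. [folklore] -/
theorem mem_cellFin [NeZero N₀] {c' : ZMod Nk} {a : ZMod N₀} : a ∈ cellFin h c' ↔ qIdx h a = c'.val := by
  unfold cellFin; simp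

/-- **RE-INDEXING A CELL BY THE CENTRED OFFSET**: `Σ_{a ∈ cell c′} F(t(a)) = Σ_{t ∈ [−h,h]} F(t)`. [folklore] -/
theorem sum_cellFin [NeZero N₀] [NeZero Nk] (hN : N₀ = side h * Nk) (F : ℤ → ℝ) (c' : ZMod Nk) :
    ∑ a ∈ (cellFin h c' : Finset (ZMod N₀)), F (tOff h a) = ∑ t ∈ Icc (-(h : ℤ)) h, F t := by
  subst hN
  have hn : side h = 2 * h + 1 := rfl
  have hc := ZMod.val_lt c'
  -- the product `c′·n` as one atom for linear arithmetic
  have eC : ((c'.val * side h : ℕ) : ℤ) = (c'.val : ℤ) * side h := by push_cast; ring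
  have eN : ((side h * Nk : ℕ) : ℤ) = (side h : ℤ) * Nk := by push_cast; ring
  have hCN : c'.val * side h + side h ≤ side h * Nk := by
    have : (c'.val + 1) * side h ≤ Nk * side h := Nat.mul_le_mul_right _ hc
    rw [Nat.add_mul, one_mul, Nat.mul_comm Nk] at this; exact this
  refine sum_nbij' (fun a => tOff h a) (fun t => (((c'.val * side h : ℕ) + (h + t).toNat : ℕ) : ZMod (side h * Nk))) ?_ ?_ ?_ ?_ ?_
  · intro a _
    rw [mem_Icc]
    exact tOff_mem h a
  · intro t ht
    rw [mem_Icc] at ht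
    rw [mem_cellFin]
    have hlt : (c'.val * side h : ℕ) + (h + t).toNat < side h * Nk := by omega
    have hsm : (h + t).toNat < side h := by omega
    unfold qIdx
    rw [ZMod.val_natCast, Nat.mod_eq_of_lt hlt, Nat.mul_comm, Nat.mul_add_div (side_pos h), Nat.div_eq_of_lt hsm, add_zero]
  · intro a ha
    rw [mem_cellFin] at ha
    have hv := val_eq h a
    have ht := tOff_mem h a
    rw [ha] at hv
    have e : (((c'.val * side h : ℕ) + (h + tOff h a).toNat : ℕ) : ℤ) = (a.val : ℤ) := by
      push_cast
      rw [Int.toNat_of_nonneg (by omega), hv]; ring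
    have e' : (c'.val * side h : ℕ) + (h + tOff h a).toNat = a.val := by exact_mod_cast e
    rw [e', ZMod.natCast_zmod_val]
  · intro t ht
    rw [mem_Icc] at ht
    have hlt : (c'.val * side h : ℕ) + (h + t).toNat < side h * Nk := by omega
    have hsm : (h + t).toNat < side h := by omega
    unfold tOff
    rw [ZMod.val_natCast, Nat.mod_eq_of_lt hlt, Nat.add_comm, Nat.add_mul_mod_self_right, Nat.mod_eq_of_lt hsm]
    omega
  · intro a _; rfl

/-- **(i) ON THE CIRCLE — EXACT CELL SUMS**: `Σ_{a ∈ cell c′} Pσ(a, c) = n·[c = c′]`. [folklore] -/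
theorem Psig_cell [NeZero N₀] [NeZero Nk] (hN : N₀ = side h * Nk) (c c' : ZMod Nk) :
    ∑ a ∈ (cellFin h c' : Finset (ZMod N₀)), Psig h a c = if c = c' then (side h : ℝ) else 0 := by
  -- inside the cell the indicator is constant: `q(a) = c′`
  have e : ∀ a ∈ (cellFin h c' : Finset (ZMod N₀)), Psig h a c = PS h (sigma h) (c'.val : ℤ) (tOff h a) c := by
    intro a ha; rw [mem_cellFin] at ha; unfold Psig; rw [ha]
  rw [sum_congr rfl e]
  unfold PS
  rw [sum_comm]
  have e2 : ∀ r ∈ trip, ∑ a ∈ (cellFin h c' : Finset (ZMod N₀)), (if c = (((c'.val : ℤ) - r : ℤ) : ZMod Nk) then sigma h (tOff h a + r * side h) else 0)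
      = if c = (((c'.val : ℤ) - r : ℤ) : ZMod Nk) then (if r = 0 then (side h : ℝ) else 0) else 0 := by
    intro r _
    by_cases hc : c = (((c'.val : ℤ) - r : ℤ) : ZMod Nk)
    · simp only [if_pos hc]
      rw [sum_cellFin h hN (fun t => sigma h (t + r * side h)), cellSum_sigma]
    · simp only [if_neg hc]
      exact sum_const_zero
  rw [sum_congr rfl e2, sum_trip]
  have hc' : (((c'.val : ℤ) - 0 : ℤ) : ZMod Nk) = c' := by simp
  simp only [hc']
  by_cases hcc : c = c'
  · simp [hcc]
  · simp [hcc]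

/-- **(ii) ON THE CIRCLE — PARTITION OF UNITY**: `Σ_c Pσ(a, c) = 1`. [folklore] -/
theorem Psig_pou [NeZero Nk] (a : ZMod N₀) : ∑ c : ZMod Nk, Psig h a c = 1 := by
  unfold Psig PS
  rw [sum_comm]
  simp_rw [sum_ite_eq']
  simp only [mem_univ, if_true]
  rw [sum_trip]
  have ht := tOff_mem h a
  have := pou_sigma h (tOff h a) ht
  rw [show tOff h a + -1 * (side h : ℤ) = tOff h a - side h by ring, show tOff h a + 0 * (side h : ℤ) = tOff h a by ring,
    show tOff h a + 1 * (side h : ℤ) = tOff h a + side h by ring]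
  exact this

/-! ## §3 Shifts and the chain identity on the circle -/

/-- **READING OFF CELL AND OFFSET**: if `b = Q·n + h + T` with `T ∈ [−h, h]` then `q(b) = Q` and `t(b) = T`. [folklore] -/
theorem qIdx_tOff_of_val {b : ZMod N₀} {Q : ℕ} {T : ℤ} (hb : (b.val : ℤ) = Q * side h + h + T) (hT1 : -(h : ℤ) ≤ T) (hT2 : T ≤ h) :
    qIdx h b = Q ∧ tOff h b = T := by
  have hn : side h = 2 * h + 1 := rfl
  have hb' : (b.val : ℤ) = ((side h * Q : ℕ) : ℤ) + h + T := by rw [hb]; push_cast; ring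
  have key := (Nat.div_mod_unique (side_pos h)).mpr
    ⟨(show (h + T).toNat + side h * Q = b.val by generalize side h * Q = M at hb' ⊢; omega), (by omega : (h + T).toNat < side h)⟩
  unfold qIdx tOff
  rw [key.1, key.2]
  exact ⟨rfl, by omega⟩

/-- The value of `a + m` on the circle. [folklore] -/
theorem val_add_nat [NeZero N₀] (a : ZMod N₀) (m : ℕ) : (a + (m : ZMod N₀)).val = (a.val + m) % N₀ := by
  rw [ZMod.val_add, ZMod.val_natCast, Nat.add_mod_mod]

/-- **A STEP INSIDE THE CELL**: if `t(a) + m ≤ h` then `a + m` lies in the same cell with offset `t(a) + m`. [folklore] -/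
theorem qIdx_tOff_add_of_le [NeZero N₀] (hN : N₀ = side h * Nk) (a : ZMod N₀) (m : ℕ) (hle : tOff h a + m ≤ h) :
    qIdx h (a + (m : ZMod N₀)) = qIdx h a ∧ tOff h (a + (m : ZMod N₀)) = tOff h a + m := by
  subst hN
  have hn : side h = 2 * h + 1 := rfl
  have hv := val_eq h a
  have ht := tOff_mem h a
  have hq := qIdx_lt h rfl a
  have hlt : a.val + m < side h * Nk := by
    have h1 : (qIdx h a + 1) * side h ≤ Nk * side h := Nat.mul_le_mul_right _ hq
    zify at h1 ⊢
    nlinarith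
  have hval : ((a + (m : ZMod (side h * Nk))).val : ℤ) = a.val + m := by
    rw [val_add_nat, Nat.mod_eq_of_lt hlt]; push_cast; ring
  exact qIdx_tOff_of_val h (by rw [hval, hv]; ring) (by omega) hle

/-- **A STEP INTO THE NEXT CELL**: if `h < t(a) + m` and `m ≤ n` then `a + m` lies in the next cell (mod `N_k`) with offset `t(a) + m − n`. [folklore] -/
theorem qIdx_tOff_add_of_lt [NeZero N₀] (hN : N₀ = side h * Nk) (a : ZMod N₀) (m : ℕ) (hm : m ≤ side h) (hlt : (h : ℤ) < tOff h a + m) :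
    ((qIdx h (a + (m : ZMod N₀)) : ℤ) : ZMod Nk) = ((qIdx h a : ℤ) : ZMod Nk) + 1 ∧ tOff h (a + (m : ZMod N₀)) = tOff h a + m - side h := by
  subst hN
  have hn : side h = 2 * h + 1 := rfl
  have hv := val_eq h a
  have ht := tOff_mem h a
  have hq := qIdx_lt h rfl a
  have hva : a.val < side h * Nk := ZMod.val_lt a
  -- the product `q·n` as one atom for linear arithmetic
  have eQ : ((qIdx h a * side h : ℕ) : ℤ) = (qIdx h a : ℤ) * side h := by push_cast; ring
  have eN : ((side h * Nk : ℕ) : ℤ) = (side h : ℤ) * Nk := by push_cast; ring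
  rcases Nat.lt_or_ge (qIdx h a + 1) Nk with hq1 | hq1
  · -- no wrap around the circle
    have hlt' : a.val + m < side h * Nk := by
      have h1 : (qIdx h a + 2) * side h ≤ Nk * side h := Nat.mul_le_mul_right _ (by omega)
      zify at h1 ⊢; nlinarith
    have hval : ((a + (m : ZMod (side h * Nk))).val : ℤ) = a.val + m := by
      rw [val_add_nat, Nat.mod_eq_of_lt hlt']; push_cast; ring
    obtain ⟨h1, h2⟩ := qIdx_tOff_of_val h (b := a + (m : ZMod (side h * Nk))) (Q := qIdx h a + 1) (T := tOff h a + m - side h)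
      (by rw [hval, hv]; push_cast; ring) (by omega) (by omega)
    refine ⟨?_, h2⟩
    rw [h1]; push_cast; ring
  · -- wrap: `q(a) = N_k − 1`, the next cell is the cell `0`
    have hqe : qIdx h a + 1 = Nk := by omega
    have hNq : (side h : ℤ) * Nk = (qIdx h a : ℤ) * side h + side h := by
      have e : (Nk : ℤ) = (qIdx h a : ℤ) + 1 := by exact_mod_cast hqe.symm
      rw [e]; ring
    have hge : side h * Nk ≤ a.val + m := by
      zify; rw [hNq, hv]; push_cast [hn] at hlt ⊢; nlinarith
    have hlt2 : a.val + m - side h * Nk < side h * Nk := by omega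
    have hval : ((a + (m : ZMod (side h * Nk))).val : ℤ) = a.val + m - (side h * Nk : ℕ) := by
      rw [val_add_nat, Nat.mod_eq_sub_mod hge, Nat.mod_eq_of_lt hlt2]; push_cast [hge]; ring
    obtain ⟨h1, h2⟩ := qIdx_tOff_of_val h (b := a + (m : ZMod (side h * Nk))) (Q := 0) (T := tOff h a + m - side h)
      (by rw [hval, hv, eN, hNq]; push_cast; ring) (by omega) (by omega)
    refine ⟨?_, h2⟩
    rw [h1]
    have e0 : (((qIdx h a + 1 : ℕ) : ℤ) : ZMod Nk) = 0 := by rw [hqe]; simp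
    push_cast at e0 ⊢
    rw [e0]

/-- **THE 0-FORM PROFILE ONE STEP ON**: `Pσ(a + 1, c) = PS σ q(a) (t(a) + 1) c` (in the next-cell case the re-basing costs nothing: the two boundary values vanish). [folklore] -/
theorem Psig_add_one [NeZero N₀] (hN : N₀ = side h * Nk) (a : ZMod N₀) (c : ZMod Nk) : Psig h (a + 1) c = PS h (sigma h) (qIdx h a) (tOff h a + 1) c := by
  have hn : (side h : ℤ) = 2 * h + 1 := side_int h
  have ht := tOff_mem h a
  have hp := two_prad_le h
  unfold Psig
  by_cases hle : tOff h a + 1 ≤ h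
  · obtain ⟨h1, h2⟩ := qIdx_tOff_add_of_le h hN a 1 (by push_cast; exact hle)
    push_cast at h1 h2
    rw [h1, h2]
  · have hlt : (h : ℤ) < tOff h a + (1 : ℕ) := by push_cast; omega
    obtain ⟨h1, h2⟩ := qIdx_tOff_add_of_lt h hN a 1 (by have := side_pos h; omega) hlt
    push_cast at h1 h2
    -- `PS σ q' t' c` only depends on `q'` through its class mod `N_k`
    have h1' : (((qIdx h (a + 1) : ℕ) : ℤ) : ZMod Nk) = ((((qIdx h a : ℕ) : ℤ) + 1 : ℤ) : ZMod Nk) := by push_cast at h1 ⊢; exact h1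
    rw [h2, PS_congr_mod h (sigma h) h1', PS_succ_sub_side]
    · exact sigma_eq_zero h (Or.inr (by omega))
    · exact sigma_eq_zero h (Or.inl (by omega))

/-- **THE 1-FORM PROFILE `m < n` STEPS ON**: `Pτ(a + m, c) = PS τ q(a) (t(a) + m) c`. [folklore] -/
theorem Ptau_add_nat [NeZero N₀] (hN : N₀ = side h * Nk) (a : ZMod N₀) (c : ZMod Nk) (m : ℕ) (hm : m < side h) :
    Ptau h (a + (m : ZMod N₀)) c = PS h (tau h) (qIdx h a) (tOff h a + m) c := by
  have hn : (side h : ℤ) = 2 * h + 1 := side_int h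
  have ht := tOff_mem h a
  have hp := two_prad_le h
  unfold Ptau
  by_cases hle : tOff h a + m ≤ h
  · obtain ⟨h1, h2⟩ := qIdx_tOff_add_of_le h hN a m hle
    rw [h1, h2]
  · have hlt : (h : ℤ) < tOff h a + m := by omega
    obtain ⟨h1, h2⟩ := qIdx_tOff_add_of_lt h hN a m hm.le hlt
    have h1' : (((qIdx h (a + (m : ZMod N₀)) : ℕ) : ℤ) : ZMod Nk) = ((((qIdx h a : ℕ) : ℤ) + 1 : ℤ) : ZMod Nk) := by push_cast at h1 ⊢; exact h1
    rw [h2, PS_congr_mod h (tau h) h1', PS_succ_sub_side]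
    · exact tau_eq_zero h (Or.inr (by omega))
    · exact tau_eq_zero h (Or.inl (by omega))

/-- `Pτ(a, c − 1) = PS τ q(a) (t(a) + n) c` (the previous cell's 1-form profile, re-based). [folklore] -/
theorem Ptau_pred (a : ZMod N₀) (c : ZMod Nk) : Ptau h a (c - 1) = PS h (tau h) (qIdx h a) (tOff h a + side h) c := by
  have hn : (side h : ℤ) = 2 * h + 1 := side_int h
  have ht := tOff_mem h a
  have hp := two_prad_le h
  unfold Ptau
  rw [← PS_succ_eq_pred, ← PS_succ_sub_side h (tau h) (qIdx h a) (tOff h a + side h) c]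
  · ring_nf
  · exact tau_eq_zero h (Or.inr (by omega))
  · exact tau_eq_zero h (Or.inl (by omega))

/-- **(iii) ON THE CIRCLE — THE CHAIN IDENTITY**: `Pσ(a+1, c) − Pσ(a, c) = Pτ(a, c−1) − Pτ(a, c)` (the discrete derivative of the spread 0-form profile is the coarse difference of
the spread 1-form profile). [folklore] -/
theorem Psig_add_one_sub [NeZero N₀] (hN : N₀ = side h * Nk) (a : ZMod N₀) (c : ZMod Nk) : Psig h (a + 1) c - Psig h a c = Ptau h a (c - 1) - Ptau h a c := by
  rw [Psig_add_one h hN, Ptau_pred h]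
  unfold Psig Ptau PS
  rw [← sum_sub_distrib, ← sum_sub_distrib]
  refine sum_congr rfl fun r _ => ?_
  split_ifs
  · have hc := sigma_succ_sub h (tOff h a + r * side h)
    rw [show tOff h a + 1 + r * (side h : ℤ) = tOff h a + r * side h + 1 by ring,
      show tOff h a + (side h : ℤ) + r * side h = tOff h a + r * side h + side h by ring]
    exact hc
  · simp

end Summit.QuantumFields.YangMills.Theorems.LinearLiftProfile

end
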